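import Mathlib
import HarnessLib
import Literature.MathematicalPhysics.QuantumFieldTheory.LatticeGaugeDobrushinPoincare
import Summits.Ventures.LatticeQCDFlow.Exactness.NCMCGeneralSpaceAcceptanceBennett

/-!
# The variance of the acceptance probability is at most the variance of the work

HONEST FRAMING: exact (Metropolis-corrected) sampling algorithms for lattice gauge theory;
figures of merit are autocorrelation/cost numbers at stated couplings and volumes; no
continuum-physics claim.

Venture `LatticeQCDFlow` (cell pub-lqcd), topic `Exactness`; FANOUT row 13 (`eng-snf`, GEN-14).
NEW WORK of the cell (elementary: a `1`-Lipschitz map does not increase the variance), not a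
published result; nothing is cited as a fact.  Continuation of `NCMCGeneralSpaceAcceptanceBennett.lean`
(GEN-14: Bennett / Bernstein tails for the reported mean acceptance with any SUPPLIED variance proxy
`v ≥ Var_F[min(1, e^{−(W−c)})]`) and of `NCMCGeneralSpaceAcceptanceCLT.lean` (GEN-13:
`Var_F[α] ≤ a_F(1 − a_F)`).  This file supplies the other natural proxy: the variance of the WORK.
The acceptance probability `α = min(1, e^{−(W−c)})` is a `1`-Lipschitz function of `W`, so
`Var_F[α] ≤ Var_F[W]` for every level constant `c` — a protocol whose work fluctuates little
(near the quasi-static limit) certifies its mean acceptance correspondingly tightly, whatever `a_F`.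

## Setting and content

* `min_one_exp_eq`, **`abs_accept_sub_accept_le`** — the acceptance probability is `1`-Lipschitz
  in the work: `|min(1,e^{−(x−c)}) − min(1,e^{−(y−c)})| ≤ |x − y|` (`exp` is `1`-Lipschitz on
  `(−∞, 0]`: the tree's folklore lemma `abs_exp_sub_exp_le_of_le` of
  `Literature/MathematicalPhysics/QuantumFieldTheory/LatticeGaugeDobrushinPoincare.lean`, reused).
* **`variance_comp_le_of_lipschitzWith_one`** — for a probability law `μ`, `X ∈ L²(μ)` and a
  `1`-Lipschitz `φ : ℝ → ℝ`: `Var_μ[φ ∘ X] ≤ Var_μ[X]`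
  (`Var[φ(X)] ≤ E(φ(X) − φ(EX))² ≤ E(X − EX)² = Var[X]`).
* For a Crooks pair `(κF, κR, s, e, W)` from `ν₀` to `ν₁` with `W ∈ L²(P_F)`:
  **`CrooksPair.variance_accept_le_variance_work`** — `Var_F[min(1, e^{−(W−c)})] ≤ Var_F[W]` for
  every `c`; hence (GEN-14's Bennett file with `v = Var_F[W]`)
  **`CrooksPair.measureReal_abs_sampleMean_accept_sub_ge_le_of_work`** —
  `P{|ᾱ_N − a_F(c)| ≥ t} ≤ 2 exp(−N t²/(2(Var_F[W] + t/3)))` whenever `Var_F[W] > 0`, and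
  **`CrooksPair.variance_accept_le_min`** — `Var_F[α] ≤ min(a_F(1 − a_F), Var_F[W])`.
  Reading for the engine (boarded `acceptance`, the work statistics `mean_w / var_w` it already
  reports): the standard error of the reported mean acceptance of `N` independent proposals is at
  most `σ_W/√N`, `σ_W² = Var_F[W]` — a protocol-quality statement: halving the work fluctuations
  halves the certified acceptance radius, independently of the acceptance level.

Scope / NOT CLAIMED: independent evolutions only; `Var_F[W]` is a population quantity (its plug-in
estimate is not covered here); for Gaussian work `Var_F[W] = 2⟨W_d⟩` is NOT used or claimed; no
value for any concrete protocol.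
-/

namespace Summit.Ventures.LatticeQCDFlow.Exactness.GeneralNCMC

open MeasureTheory ProbabilityTheory Set Filter Finset
open scoped ENNReal NNReal Topology

variable {E : Type*} [MeasurableSpace E]

/-! ## The acceptance probability is `1`-Lipschitz in the work -/

/-- `min(1, e^{s}) = e^{min(0, s)}`. -/
theorem min_one_exp_eq (s : ℝ) : min 1 (Real.exp s) = Real.exp (min 0 s) := by
  rcases le_total 0 s with hs | hs
  · rw [min_eq_left hs, Real.exp_zero, min_eq_left (Real.one_le_exp hs)]
  · rw [min_eq_right hs, min_eq_right (Real.exp_le_one_iff.2 hs)]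

/-- **The Metropolis acceptance probability is `1`-Lipschitz in the work**:
`|min(1, e^{−(x−c)}) − min(1, e^{−(y−c)})| ≤ |x − y|`. -/
theorem abs_accept_sub_accept_le (c x y : ℝ) :
    |min 1 (Real.exp (-(x - c))) - min 1 (Real.exp (-(y - c)))| ≤ |x - y| := by
  rw [min_one_exp_eq, min_one_exp_eq]
  -- `exp` is `1`-Lipschitz on `(−∞, 0]` (folklore; the tree's lattice-gauge Dobrushin file, reused)
  have hexp := Literature.MathematicalPhysics.QuantumFieldTheory.abs_exp_sub_exp_le_of_le
    (min_le_left (0 : ℝ) (-(x - c))) (min_le_left (0 : ℝ) (-(y - c)))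
  rw [Real.exp_zero, one_mul] at hexp
  refine hexp.trans ?_
  refine (abs_min_sub_min_le_max 0 (-(x - c)) 0 (-(y - c))).trans ?_
  rw [sub_self, abs_zero, show -(x - c) - -(y - c) = y - x by ring, abs_sub_comm y x]
  exact max_le (abs_nonneg _) le_rfl

/-! ## A `1`-Lipschitz map does not increase the variance -/

section Variance

variable (μ : Measure E) [IsProbabilityMeasure μ]

/-- **`Var_μ[φ ∘ X] ≤ Var_μ[X]`** for `X ∈ L²(μ)` and a `1`-Lipschitz `φ : ℝ → ℝ`: the variance is at
most the mean square deviation from ANY constant, here `φ(E X)`, and `|φ(X) − φ(EX)| ≤ |X − EX|`. -/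
theorem variance_comp_le_of_lipschitzWith_one {X : E → ℝ} (hX : MemLp X 2 μ) {φ : ℝ → ℝ}
    (hφ : LipschitzWith 1 φ) : Var[fun x => φ (X x); μ] ≤ Var[X; μ] := by
  set m := ∫ x, X x ∂μ with hm
  have hXm : AEStronglyMeasurable X μ := hX.aestronglyMeasurable
  have hφm : Measurable φ := hφ.continuous.measurable
  have hcm : AEStronglyMeasurable (fun x => φ (X x) - φ m) μ :=
    (hφm.comp_aemeasurable hX.aemeasurable).aestronglyMeasurable.sub aestronglyMeasurable_const
  have hlip : ∀ x, |φ (X x) - φ m| ≤ |X x - m| := fun x => by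
    have h := hφ.dist_le_mul (X x) m
    rwa [NNReal.coe_one, one_mul, Real.dist_eq, Real.dist_eq] at h
  have h1 : Var[fun x => φ (X x); μ] = Var[fun x => φ (X x) - φ m; μ] :=
    (variance_sub_const (hφm.comp_aemeasurable hX.aemeasurable).aestronglyMeasurable (φ m)).symm
  have h2 : Var[fun x => φ (X x) - φ m; μ] ≤ ∫ x, (φ (X x) - φ m) ^ 2 ∂μ := by
    have h := variance_le_expectation_sq (μ := μ) (X := fun x => φ (X x) - φ m) hcm
    simpa only [Pi.pow_apply] using h
  have h3 : ∫ x, (φ (X x) - φ m) ^ 2 ∂μ ≤ ∫ x, (X x - m) ^ 2 ∂μ :=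
    integral_mono_of_nonneg (Eventually.of_forall fun x => sq_nonneg _)
      (hX.sub (memLp_const m)).integrable_sq
      (Eventually.of_forall fun x => sq_le_sq.2 (hlip x))
  have h4 : ∫ x, (X x - m) ^ 2 ∂μ = Var[X; μ] := (variance_eq_integral hX.aemeasurable).symm
  calc Var[fun x => φ (X x); μ] = Var[fun x => φ (X x) - φ m; μ] := h1
    _ ≤ ∫ x, (φ (X x) - φ m) ^ 2 ∂μ := h2
    _ ≤ ∫ x, (X x - m) ^ 2 ∂μ := h3
    _ = Var[X; μ] := h4

/-- **`Var_μ[min(1, e^{−(W−c)})] ≤ Var_μ[W]`** for a measurable work `W ∈ L²(μ)` and every `c`. -/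
theorem variance_accept_le_variance {W : E → ℝ} (hW2 : MemLp W 2 μ) (c : ℝ) :
    Var[fun ε => min 1 (Real.exp (-(W ε - c))); μ] ≤ Var[W; μ] :=
  variance_comp_le_of_lipschitzWith_one μ hW2 (φ := fun x => min 1 (Real.exp (-(x - c))))
    (LipschitzWith.mk_one fun x y => by
      rw [Real.dist_eq, Real.dist_eq]
      exact abs_accept_sub_accept_le c x y)

end Variance

/-! ## For a Crooks pair: the work variance certifies the reported acceptance -/

namespace CrooksPair

variable {Ω : Type*} [MeasurableSpace Ω]
variable {ν₀ ν₁ : Measure Ω} {κF κR : Kernel Ω E} {s e : E → Ω} {W : E → ℝ}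

/-- **`Var_F[min(1, e^{−(W−c)})] ≤ Var_F[W]`**: for every Crooks pair with `W ∈ L²(P_F)` and every
level constant `c`, the variance of the acceptance probability under the forward path law is at
most the variance of the work. -/
theorem variance_accept_le_variance_work [IsFiniteMeasure ν₀] [IsMarkovKernel κF]
    (h0 : ν₀ univ ≠ 0) (hW2 : MemLp W 2 (fwdPathLaw ν₀ κF)) (c : ℝ) :
    Var[fun ε => min 1 (Real.exp (-(W ε - c))); fwdPathLaw ν₀ κF] ≤ Var[W; fwdPathLaw ν₀ κF] := by
  haveI := isProbabilityMeasure_fwdPathLaw ν₀ h0 κF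
  exact variance_accept_le_variance (fwdPathLaw ν₀ κF) hW2 c

/-- **Both proxies at once**: `Var_F[α] ≤ min(a_F(c)(1 − a_F(c)), Var_F[W])`
(GEN-13's Bernoulli cap `CrooksPair.variance_accept_le` and the work variance). -/
theorem variance_accept_le_min [IsFiniteMeasure ν₀] [IsMarkovKernel κF] (h0 : ν₀ univ ≠ 0)
    (h : CrooksPair ν₀ ν₁ κF κR s e W) (hW2 : MemLp W 2 (fwdPathLaw ν₀ κF)) (c : ℝ) :
    Var[fun ε => min 1 (Real.exp (-(W ε - c))); fwdPathLaw ν₀ κF] ≤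
      min ((∫ ε, min 1 (Real.exp (-(W ε - c))) ∂(fwdPathLaw ν₀ κF)) *
        (1 - ∫ ε, min 1 (Real.exp (-(W ε - c))) ∂(fwdPathLaw ν₀ κF))) (Var[W; fwdPathLaw ν₀ κF]) :=
  le_min (h.variance_accept_le h0 c) (variance_accept_le_variance_work h0 hW2 c)

/-- **Bernstein tail for the reported acceptance with the work variance as proxy**: for every Crooks
pair with `W ∈ L²(P_F)` and `Var_F[W] > 0`, every `c`, `N ≥ 1` independent forward evolutions and
`t > 0`, `P{|ᾱ_N − a_F(c)| ≥ t} ≤ 2 exp(−N t²/(2(Var_F[W] + t/3)))`. -/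
theorem measureReal_abs_sampleMean_accept_sub_ge_le_of_work [IsFiniteMeasure ν₀] [IsMarkovKernel κF]
    (h0 : ν₀ univ ≠ 0) (h : CrooksPair ν₀ ν₁ κF κR s e W) (hW2 : MemLp W 2 (fwdPathLaw ν₀ κF))
    (hvar : 0 < Var[W; fwdPathLaw ν₀ κF]) (c : ℝ) {N : ℕ} (hN : 0 < N) {t : ℝ} (ht : 0 < t) :
    haveI := isProbabilityMeasure_fwdPathLaw ν₀ h0 κF
    (Measure.pi fun _ : Fin N => fwdPathLaw ν₀ κF).real
        {y | t ≤ |sampleMean (fun ε => min 1 (Real.exp (-(W ε - c)))) y -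
          ∫ ε, min 1 (Real.exp (-(W ε - c))) ∂(fwdPathLaw ν₀ κF)|} ≤
      2 * Real.exp (-(N * t ^ 2 / (2 * (Var[W; fwdPathLaw ν₀ κF] + t / 3)))) :=
  h.measureReal_abs_sampleMean_accept_sub_ge_le_of_variance_le h0 c hN ht hvar
    (variance_accept_le_variance_work h0 hW2 c)

end CrooksPair

end Summit.Ventures.LatticeQCDFlow.Exactness.GeneralNCMC
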